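/-
Copyright: the b2b-balaban T⁴-continuum CRUX team, row NE7b leaf lineage `t4-ne7b-formalise-leaf-02` (gen 136). Project licence.
-/
import Summits.QuantumFields.BalabanUV.T4Continuum.Spine.NE7b.FlatFullFormFloorTorus
import Summits.QuantumFields.BalabanUV.T4Continuum.Spine.NE7b.AdmissibleFloorFlatComponents
import Literature.MathematicalPhysics.QuantumLattice.LatticeWilsonFlow

/-!
# THE FLAT FULL-FORM FLOOR ON THE TWO-SCALE TORUS IN BOTH CURRENCIES OF `M_m(ℂ)`: `…FlatFullFormFloorTorus` (the U = 1 (h2) floor, Hilbert–Schmidt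
# currency of any real inner-product space) INSTANTIATED at `W := M_m(ℂ)` with print's Hilbert–Schmidt inner product `Re tr(A†B)` (the tree's
# `QuantumLattice.frobeniusInnerProductSpace` over Mathlib's scoped Frobenius norm), and TRANSFERRED to the operator currency of the row's E-side
# (`‖·‖_op = ‖Matrix.toEuclideanCLM ·‖`, `…AdmissibleFloorFlatComponents.opNorm_floor_of_frobenius_floor`) at the printed price `|m|`
# (row NE7b, node U5c; residual (R2′) family (2), letter (ℓ1); E-side junction lemma — the (flat) letter at `U = 1` on BOTH sides of Q-leaf05-g157-1)

Cell `pub-balaban`, sub-cell `t4`, spine estimate NE7b (`T4WeightBudget.RelWeightBound`; the cell's OWN estimate — NOT PRINTED in [Bałaban 1983–89],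
NOT PROVED).  Crux-route work under `Spine/NE7b/` by a row leaf (`t4-ne7b-formalise-leaf-02`, gen 136) under FREEZE (0)'s crux-prover clause; [folklore]
bookkeeping; NOTHING of Bałaban's is asserted beyond what the cited modules prove; no `def` (the Frobenius inner product is the tree's `@[reducible] def`,
activated INSIDE the one proof that needs it by a term-level `letI` — statements carry only Mathlib's scoped Frobenius norm); zero `sorry`; no `T4Continuum/Support` leaf.
Imports: this lineage's `…FlatFullFormFloorTorus` (FFFT `flat_full_form_floor_torus_weighted`), leaf-05's `…AdmissibleFloorFlatComponents` (AFFC §4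
`opNorm_floor_of_frobenius_floor`; through it HSCL's two comparison letters `‖A‖_op ≤ ‖A‖_HS`, `‖A‖²_HS ≤ |m|·‖A‖²_op` — [B7] (20) p. 21), and
`Literature.….QuantumLattice.LatticeWilsonFlow` (`frobeniusInnerProductSpace : InnerProductSpace ℝ (Matrix m n ℂ)`, norm = Mathlib's scoped Frobenius norm,
«no instance diamond arises under `open scoped Matrix.Norms.Frobenius`»).

WHY.  The row's (h2) files run in two currencies and the choice is the OWNER's (Q-leaf05-g157-1 UNRULED): the E-side's `…CurlTermsLinear` ∕ `…AverageTermsLinear`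
∕ `…FullFormSineFloor(Sq)` read `𝔤 ⊂ M_m(ℂ)` with an operator-type norm (`NormedRing`, `norm_conjR_le`), while the PROVED flat floor ([B6] Lemma 2.4,
`…FlatFloorLemma24Vector`, FFFT) is a Parseval statement and lives in the Hilbert–Schmidt currency.  AFFC §4 typed the bridge for ANY family of terms: an HS
floor `c·Σ‖x c‖²_HS ≤ Σ_j‖T_j x‖²_HS` gives the op floor `(c∕|m|)·Σ‖x c‖²_op ≤ Σ_j‖T_j x‖²_op` ([B7] (20): `‖X‖ ≤ |X| ≤ √N‖X‖`).  THIS FILE instantiates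
both ends at `U = 1` on the torus: §1 reads FFFT on `M_m(ℂ)`-valued bond fields in the HS currency (the instance is one `letI` away, inside the proof),
§2 packages the full form's two families as ONE family over `plaquettes ⊕ coarse bonds` and applies AFFC §4.  After it the U = 1 (flat) input of the (h2)
slot is a tree theorem in BOTH currencies, so the instance does not wait on the currency ruling.

WHAT IS PROVED ([folklore]; `m` a nonempty Fintype, `‖·‖` on `Matrix m m ℂ` = Frobenius (scoped), `‖·‖_op := ‖Matrix.toEuclideanCLM ·‖`; TPI's `ι`∕`hι`,
TAI's `ιA`∕`hιA`, the tree gauge `hT` VERBATIM as in FFFT):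
* §1 **`flat_full_form_floor_torus_frobenius`** — FFFT `flat_full_form_floor_torus_weighted` at `W := Matrix m m ℂ` under `frobeniusInnerProductSpace`:
  `1∕(12d²)·(n^{d+1})⁻¹·Σ_c‖B c‖²_HS ≤ Σ_j‖(√(n^{d−2})·(n^{d+1})⁻¹) • Σ_{rt} B(ιA j rt)‖²_HS + Σ_P‖B(ι P 0) + B(ι P 1) − B(ι P 2) − B(ι P 3)‖²_HS`.
* §2 **`flat_full_form_floor_torus_op`** (the two families as one family over `plaquettes ⊕ coarse bonds`, `Fintype.sum_sum_type`) — the operator-currency floor at price `|m|`: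
  `(1∕(12d²)·(n^{d+1})⁻¹ ∕ |m|)·Σ_c‖B c‖²_op ≤ Σ_P‖B(ι P 0) + B(ι P 1) − B(ι P 2) − B(ι P 3)‖²_op + Σ_j‖(√(n^{d−2})·(n^{d+1})⁻¹) • Σ_{rt} B(ιA j rt)‖²_op`.
* §3 toy: `d = 2`, `n = M = 1`, `m = Fin 1`, `B = 0` — §2 elaborates (junction by elaboration).

NOT HERE (honest): which currency the row adopts (OWNER); the identification of `‖Matrix.toEuclideanCLM ·‖` with the `NormedRing` instance a consumer puts on
`𝔸 := M_m(ℂ)` in `…CurlTermsLinear` ∕ `…FullFormSineFloor(Sq)` (the cell's `UnitaryModel` (19); a one-line `rfl`∕`norm_cast` junction for whoever instantiates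
`𝔸` — not asserted here); `U ≠ 1`; (A3); anything of Bałaban's beyond [B6] Lemma 2.4 PROVED and [B7] (20) PROVED.  BY-NAME EFFECT ON THE WALL: NONE.
NE7b NOT PRINTED ∕ NOT PROVED; spine PROVED 0∕9; rung (B)+1 on ONE finite T⁴ — NOT infinite volume, NOT the mass gap, NOT Clay.
HONEST DEPENDENCY: continuum YM on T⁴ ⇐ BetaPertH ∧ nine spine estimates (0/9 proved); BetaPertH ⇐ (D1) ∧ (D4) ∧ CAP+tail; G-an2-4 gates asym, D1 and NE2/3/4.
-/

set_option autoImplicit false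

noncomputable section

open Finset
open scoped Matrix.Norms.Frobenius
open Literature.MathematicalPhysics.QuantumFieldTheory.Balaban1983to89.T4TermwiseTorus (tcls)
open Literature.MathematicalPhysics.QuantumFieldTheory.Balaban1983to89.B6BondElimination (treeBonds)
open Literature.MathematicalPhysics.QuantumFieldTheory.Balaban1983to89.B6Lemma24Torus (coarseSites)
open Summit.QuantumFields.BalabanUV.T4Continuum.NE7b.FlatFullFormFloorTorus (flat_full_form_floor_torus_weighted)
open Summit.QuantumFields.BalabanUV.T4Continuum.NE7b.AdmissibleFloorFlatComponents (opNorm_floor_of_frobenius_floor)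


namespace Summit.QuantumFields.BalabanUV.T4Continuum.NE7b.FlatFullFormFloorTorusOp

variable {d : ℕ} {m : Type*} [Fintype m] [DecidableEq m]

/-! ## §1 The Hilbert–Schmidt currency on `M_m(ℂ)`: FFFT instantiated -/

/-- **THE U = 1 FLOOR FOR `M_m(ℂ)`-VALUED BOND FIELDS IN THE HILBERT–SCHMIDT CURRENCY** (`‖A‖² = Re tr(A†A)`, [B7] (17)): FFFT
`flat_full_form_floor_torus_weighted` at `W := Matrix m m ℂ` under the tree's `frobeniusInnerProductSpace`. [folklore] -/
theorem flat_full_form_floor_torus_frobenius (hd : 2 ≤ d) (n M : ℕ) [NeZero n] [NeZero M] [NeZero (n * M)]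
    (ι : (Fin d → ZMod (n * M)) × {a : Fin d × Fin d // a.1 < a.2} → Fin 4 → (Fin d → ZMod (n * M)) × Fin d)
    (hι : ∀ x a, ι (x, a) = ![(x, a.1.1), (x + Pi.single a.1.1 1, a.1.2), (x + Pi.single a.1.2 1, a.1.1), (x, a.1.2)])
    (ιA : (Fin d → ZMod M) × Fin d → (Fin d → Fin n) × Fin n → (Fin d → ZMod (n * M)) × Fin d)
    (hιA : ∀ y κ r t, ιA (y, κ) (r, t) =
      ((fun i => (((y i).val * n + (r i : ℕ) : ℕ) : ZMod (n * M))) + Pi.single κ ((t : ℕ) : ZMod (n * M)), κ))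
    (B : (Fin d → ZMod (n * M)) × Fin d → Matrix m m ℂ)
    (hT : ∀ y ∈ coarseSites n (fun _ : Fin d => n * M), ∀ bd ∈ treeBonds n y, B (tcls (n * M) bd.1, bd.2) = 0) :
    1 / (12 * (d : ℝ) ^ 2) * ((n : ℝ) ^ (d + 1))⁻¹ * ∑ c, ‖B c‖ ^ 2 ≤
      ∑ j, ‖(Real.sqrt ((n : ℝ) ^ (d - 2)) * ((n : ℝ) ^ (d + 1))⁻¹) • ∑ rt, B (ιA j rt)‖ ^ 2
        + ∑ P, ‖B (ι P 0) + B (ι P 1) - B (ι P 2) - B (ι P 3)‖ ^ 2 :=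
  letI := Literature.MathematicalPhysics.QuantumLattice.frobeniusInnerProductSpace (m := m) (n := m)
  flat_full_form_floor_torus_weighted (W := Matrix m m ℂ) hd n M ι hι ιA hιA B hT

/-! ## §2 The operator currency at price `|m|` -/

/-- **THE U = 1 FLOOR IN THE OPERATOR CURRENCY, PRICE `|m|`** (AFFC §4 on §1, the two families packaged as one; [B7] (20) `‖X‖ ≤ |X| ≤ √N‖X‖`):
`(1∕(12d²)·(n^{d+1})⁻¹∕|m|)·Σ_c‖B c‖²_op ≤ Σ_P‖B(ι P 0) + B(ι P 1) − B(ι P 2) − B(ι P 3)‖²_op + Σ_j‖(√(n^{d−2})·(n^{d+1})⁻¹) • Σ_{rt} B(ιA j rt)‖²_op`,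
`‖·‖_op = ‖Matrix.toEuclideanCLM ·‖`. [folklore] -/
theorem flat_full_form_floor_torus_op [Nonempty m] (hd : 2 ≤ d) (n M : ℕ) [NeZero n] [NeZero M] [NeZero (n * M)]
    (ι : (Fin d → ZMod (n * M)) × {a : Fin d × Fin d // a.1 < a.2} → Fin 4 → (Fin d → ZMod (n * M)) × Fin d)
    (hι : ∀ x a, ι (x, a) = ![(x, a.1.1), (x + Pi.single a.1.1 1, a.1.2), (x + Pi.single a.1.2 1, a.1.1), (x, a.1.2)])
    (ιA : (Fin d → ZMod M) × Fin d → (Fin d → Fin n) × Fin n → (Fin d → ZMod (n * M)) × Fin d)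
    (hιA : ∀ y κ r t, ιA (y, κ) (r, t) =
      ((fun i => (((y i).val * n + (r i : ℕ) : ℕ) : ZMod (n * M))) + Pi.single κ ((t : ℕ) : ZMod (n * M)), κ))
    (B : (Fin d → ZMod (n * M)) × Fin d → Matrix m m ℂ)
    (hT : ∀ y ∈ coarseSites n (fun _ : Fin d => n * M), ∀ bd ∈ treeBonds n y, B (tcls (n * M) bd.1, bd.2) = 0) :
    1 / (12 * (d : ℝ) ^ 2) * ((n : ℝ) ^ (d + 1))⁻¹ / Fintype.card m * ∑ c, ‖Matrix.toEuclideanCLM (n := m) (𝕜 := ℂ) (B c)‖ ^ 2 ≤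
      ∑ P, ‖Matrix.toEuclideanCLM (n := m) (𝕜 := ℂ) (B (ι P 0) + B (ι P 1) - B (ι P 2) - B (ι P 3))‖ ^ 2
        + ∑ j, ‖Matrix.toEuclideanCLM (n := m) (𝕜 := ℂ)
            ((Real.sqrt ((n : ℝ) ^ (d - 2)) * ((n : ℝ) ^ (d + 1))⁻¹) • ∑ rt, B (ιA j rt))‖ ^ 2 := by
  have hc : 0 ≤ 1 / (12 * (d : ℝ) ^ 2) * ((n : ℝ) ^ (d + 1))⁻¹ := by positivity
  have key := opNorm_floor_of_frobenius_floor (n := m)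
    (fun (jj : ((Fin d → ZMod (n * M)) × {a : Fin d × Fin d // a.1 < a.2}) ⊕ ((Fin d → ZMod M) × Fin d))
        (x : (Fin d → ZMod (n * M)) × Fin d → Matrix m m ℂ) =>
      Sum.elim (fun P => x (ι P 0) + x (ι P 1) - x (ι P 2) - x (ι P 3))
        (fun j => (Real.sqrt ((n : ℝ) ^ (d - 2)) * ((n : ℝ) ^ (d + 1))⁻¹) • ∑ rt, x (ιA j rt)) jj)
    (fun x => ∀ y ∈ coarseSites n (fun _ : Fin d => n * M), ∀ bd ∈ treeBonds n y, x (tcls (n * M) bd.1, bd.2) = 0)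
    hc (fun x hx => ?_) B hT
  · rw [Fintype.sum_sum_type] at key
    simpa only [Sum.elim_inl, Sum.elim_inr] using key
  · rw [Fintype.sum_sum_type]
    simp only [Sum.elim_inl, Sum.elim_inr]
    exact (flat_full_form_floor_torus_frobenius hd n M ι hι ιA hιA x hx).trans (le_of_eq (add_comm _ _))

/-! ## §3 Toy: `d = 2`, `n = M = 1`, `m = Fin 1`, the zero field -/

/- One-point two-scale torus, `1 × 1` complex matrices, `B = 0`, incidences by their lambdas fed by `rfl`: §2 elaborates (junction by elaboration). -/
example : 1 / (12 * ((2 : ℕ) : ℝ) ^ 2) * (((1 : ℕ) : ℝ) ^ (2 + 1))⁻¹ / Fintype.card (Fin 1) *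
      ∑ c : (Fin 2 → ZMod (1 * 1)) × Fin 2, ‖Matrix.toEuclideanCLM (n := Fin 1) (𝕜 := ℂ)
        ((fun _ : (Fin 2 → ZMod (1 * 1)) × Fin 2 => (0 : Matrix (Fin 1) (Fin 1) ℂ)) c)‖ ^ 2 ≤
    ∑ P : (Fin 2 → ZMod (1 * 1)) × {a : Fin 2 × Fin 2 // a.1 < a.2},
        ‖Matrix.toEuclideanCLM (n := Fin 1) (𝕜 := ℂ)
          ((fun _ : (Fin 2 → ZMod (1 * 1)) × Fin 2 => (0 : Matrix (Fin 1) (Fin 1) ℂ))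
              ((fun (q : (Fin 2 → ZMod (1 * 1)) × {a : Fin 2 × Fin 2 // a.1 < a.2}) =>
                ![(q.1, q.2.1.1), (q.1 + Pi.single q.2.1.1 1, q.2.1.2), (q.1 + Pi.single q.2.1.2 1, q.2.1.1), (q.1, q.2.1.2)]) P 0)
            + (fun _ : (Fin 2 → ZMod (1 * 1)) × Fin 2 => (0 : Matrix (Fin 1) (Fin 1) ℂ))
              ((fun (q : (Fin 2 → ZMod (1 * 1)) × {a : Fin 2 × Fin 2 // a.1 < a.2}) =>
                ![(q.1, q.2.1.1), (q.1 + Pi.single q.2.1.1 1, q.2.1.2), (q.1 + Pi.single q.2.1.2 1, q.2.1.1), (q.1, q.2.1.2)]) P 1)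
            - (fun _ : (Fin 2 → ZMod (1 * 1)) × Fin 2 => (0 : Matrix (Fin 1) (Fin 1) ℂ))
              ((fun (q : (Fin 2 → ZMod (1 * 1)) × {a : Fin 2 × Fin 2 // a.1 < a.2}) =>
                ![(q.1, q.2.1.1), (q.1 + Pi.single q.2.1.1 1, q.2.1.2), (q.1 + Pi.single q.2.1.2 1, q.2.1.1), (q.1, q.2.1.2)]) P 2)
            - (fun _ : (Fin 2 → ZMod (1 * 1)) × Fin 2 => (0 : Matrix (Fin 1) (Fin 1) ℂ))
              ((fun (q : (Fin 2 → ZMod (1 * 1)) × {a : Fin 2 × Fin 2 // a.1 < a.2}) =>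
                ![(q.1, q.2.1.1), (q.1 + Pi.single q.2.1.1 1, q.2.1.2), (q.1 + Pi.single q.2.1.2 1, q.2.1.1), (q.1, q.2.1.2)]) P 3))‖ ^ 2 +
      ∑ j : (Fin 2 → ZMod 1) × Fin 2, ‖Matrix.toEuclideanCLM (n := Fin 1) (𝕜 := ℂ)
        ((Real.sqrt (((1 : ℕ) : ℝ) ^ (2 - 2)) * (((1 : ℕ) : ℝ) ^ (2 + 1))⁻¹) •
          ∑ rt : (Fin 2 → Fin 1) × Fin 1, (fun _ : (Fin 2 → ZMod (1 * 1)) × Fin 2 => (0 : Matrix (Fin 1) (Fin 1) ℂ))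
            ((fun (j : (Fin 2 → ZMod 1) × Fin 2) (rt : (Fin 2 → Fin 1) × Fin 1) =>
              ((fun i => (((j.1 i).val * 1 + (rt.1 i : ℕ) : ℕ) : ZMod (1 * 1))) + Pi.single j.2 ((rt.2 : ℕ) : ZMod (1 * 1)), j.2)) j rt))‖ ^ 2 := by
  haveI : NeZero (1 * 1) := ⟨by norm_num⟩
  exact flat_full_form_floor_torus_op (m := Fin 1) le_rfl 1 1
    (fun q => ![(q.1, q.2.1.1), (q.1 + Pi.single q.2.1.1 1, q.2.1.2), (q.1 + Pi.single q.2.1.2 1, q.2.1.1), (q.1, q.2.1.2)])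
    (fun _ _ => rfl)
    (fun j rt => ((fun i => (((j.1 i).val * 1 + (rt.1 i : ℕ) : ℕ) : ZMod (1 * 1))) + Pi.single j.2 ((rt.2 : ℕ) : ZMod (1 * 1)), j.2))
    (fun _ _ _ _ => rfl) (fun _ => 0) (fun _ _ _ _ => rfl)

end Summit.QuantumFields.BalabanUV.T4Continuum.NE7b.FlatFullFormFloorTorusOp

end
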